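import Literature.Geometry.GeometricMeasureTheory.CurrentsRepresentable

/-!
# The mass of push-forwards of representable currents: `‖f_# T‖ ≤ f_#(‖T‖ ⌞ |χ| ‖Df‖ᵐ)`

Federer 4.1.7/4.1.14: for a current `T` representable by integration and a smooth `f` with cutoff
`χ`, the push-forward `f_# T` (of `CurrentsPushforward.lean`) satisfies the *integral* mass bound

* `Current.IsRepresentable.variationOn_pushforward_le :
  ‖f_# T‖(U) ≤ ∫⁻_{f⁻¹ U} |χ| ‖Df‖ᵐ d‖T‖` for open `U`, whence
* `mass_pushforward_le_lintegral : 𝐌(f_# T) ≤ ∫⁻ |χ| ‖Df‖ᵐ d‖T‖`,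
  `mass_pushforward_ne_top`, `IsRepresentable.pushforward` (push-forwards of representable currents
  are representable), and the measure form
* `variation_pushforward_le_map : ‖f_# T‖ ≤ f_#(‖T‖ ⌞ |χ| ‖Df‖ᵐ)`.

(The sup-form bound `𝐌(f_# T) ≤ Lᵐ 𝐌(T)` is `Current.mass_pushforward_le` in `CurrentsPushforward`.)

## References

* H. Federer, *Geometric Measure Theory*, Springer 1969, 4.1.7, 4.1.14 [Federer1969].
-/

noncomputable section

open scoped Distributions ENNReal NNReal Topology ContDiff
open MeasureTheory TopologicalSpace Set Filter Metric Function

namespace Literature.Geometry.GeometricMeasureTheory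

set_option maxSynthPendingDepth 3

/-! ### Integral mass bounds for push-forwards of representable currents -/

section PushforwardMass

variable {E E' : Type*} [NormedAddCommGroup E] [NormedSpace ℝ E] [FiniteDimensional ℝ E]
  [MeasurableSpace E] [BorelSpace E] [NormedAddCommGroup E'] [NormedSpace ℝ E']
  {Ω : Opens E} {Ω' : Opens E'} {m : ℕ}

/-- The density `|χ| ‖Df‖ᵐ` governing the mass of a push-forward. [cite: Federer1969, 4.1.7] -/
def pushforwardDensity (χ : 𝓓(Ω, ℝ)) (f : E → E') (m : ℕ) (x : E) : ℝ≥0∞ :=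
  ENNReal.ofReal (|χ x| * ‖fderiv ℝ f x‖ ^ m)

/-- **`‖f_# T‖(U) ≤ ∫_{f⁻¹ U} |χ| ‖Df‖ᵐ d‖T‖`** for a representable current `T` and open `U`
(Federer 4.1.7/4.1.14: `‖f_# T‖ ≤ f_#(‖Df‖ᵐ ‖T‖)`, the integral form of the mass bound).
[cite: Federer1969, 4.1.7] -/
theorem Current.IsRepresentable.variationOn_pushforward_le {T : Current Ω m}
    (hT : T.IsRepresentable) (χ : 𝓓(Ω, ℝ)) {f : E → E'} (hf : ContDiff ℝ ∞ f) {U : Set E'}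
    (hU : IsOpen U) :
    (T.pushforward Ω' χ hf).variationOn U ≤
      ∫⁻ x in f ⁻¹' U, pushforwardDensity χ f m x ∂T.variation := by
  refine iSup_le fun φ => iSup_le fun hφ => iSup_le fun hφU => ?_
  rw [Current.pushforward_apply]
  refine (hT.ofReal_apply_le_lintegral _).trans ?_
  have hmeas : MeasurableSet (f ⁻¹' U) := (hU.preimage hf.continuous).measurableSet
  rw [← lintegral_indicator hmeas]
  refine lintegral_mono fun x => ?_
  rw [← ofReal_norm]
  by_cases hx : x ∈ f ⁻¹' U
  · rw [indicator_of_mem hx]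
    simp only [pushforwardDensity]
    apply ENNReal.ofReal_le_ofReal
    calc ‖TestForm.pullback χ hf φ x‖ ≤ |χ x| * ‖φ (f x)‖ * ‖fderiv ℝ f x‖ ^ m :=
          TestForm.norm_pullback_apply_le χ hf φ x
      _ ≤ |χ x| * 1 * ‖fderiv ℝ f x‖ ^ m :=
          mul_le_mul_of_nonneg_right (mul_le_mul_of_nonneg_left (hφ (f x)) (abs_nonneg _))
            (pow_nonneg (norm_nonneg _) _)
      _ = |χ x| * ‖fderiv ℝ f x‖ ^ m := by rw [mul_one]
  · rw [indicator_of_notMem hx]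
    have : TestForm.pullback χ hf φ x = 0 := by
      rw [TestForm.pullback_apply, image_eq_zero_of_notMem_tsupport (fun h => hx (hφU h))]
      exact smul_eq_zero_of_right _ (by ext v; simp)
    rw [this, norm_zero, ENNReal.ofReal_zero]

/-- **`𝐌(f_# T) ≤ ∫ |χ| ‖Df‖ᵐ d‖T‖`.** [cite: Federer1969, 4.1.7] -/
theorem Current.IsRepresentable.mass_pushforward_le_lintegral {T : Current Ω m}
    (hT : T.IsRepresentable) (χ : 𝓓(Ω, ℝ)) {f : E → E'} (hf : ContDiff ℝ ∞ f) :
    (T.pushforward Ω' χ hf).mass ≤ ∫⁻ x, pushforwardDensity χ f m x ∂T.variation := by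
  rw [← Current.variationOn_univ]
  simpa using hT.variationOn_pushforward_le χ hf isOpen_univ

/-- The density is bounded on `spt χ` and vanishes off it; in particular
`∫ |χ| ‖Df‖ᵐ d‖T‖ < ∞` for representable `T`. [cite: Federer1969, 4.1.7] -/
theorem Current.IsRepresentable.lintegral_pushforwardDensity_ne_top {T : Current Ω m}
    (hT : T.IsRepresentable) (χ : 𝓓(Ω, ℝ)) {f : E → E'} (hf : ContDiff ℝ ∞ f) :
    ∫⁻ x, pushforwardDensity χ f m x ∂T.variation ≠ ⊤ := by
  -- a bound for the continuous density on the compact support of `χ`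
  have hc : Continuous fun x => |χ x| * ‖fderiv ℝ f x‖ ^ m :=
    (continuous_abs.comp χ.continuous).mul ((hf.continuous_fderiv (by simp)).norm.pow m)
  obtain ⟨M, hM⟩ := (χ.hasCompactSupport.isCompact.image hc).bddAbove
  have hMx : ∀ x ∈ tsupport ⇑χ, |χ x| * ‖fderiv ℝ f x‖ ^ m ≤ M := fun x hx =>
    hM (mem_image_of_mem _ hx)
  have hle : (fun x => pushforwardDensity χ f m x) ≤
      (tsupport ⇑χ).indicator fun _ => ENNReal.ofReal M := by
    intro x
    by_cases hx : x ∈ tsupport ⇑χ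
    · rw [indicator_of_mem hx]; exact ENNReal.ofReal_le_ofReal (hMx x hx)
    · rw [indicator_of_notMem hx]
      simp only [pushforwardDensity]
      rw [image_eq_zero_of_notMem_tsupport hx, abs_zero, zero_mul, ENNReal.ofReal_zero]
  refine ne_top_of_le_ne_top ?_ (lintegral_mono hle)
  rw [lintegral_indicator_const (isClosed_tsupport _).measurableSet]
  exact ENNReal.mul_ne_top ENNReal.ofReal_ne_top (hT _ χ.hasCompactSupport χ.tsupport_subset)

/-- Push-forwards of representable currents have finite mass. [cite: Federer1969, 4.1.7] -/
theorem Current.IsRepresentable.mass_pushforward_ne_top {T : Current Ω m}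
    (hT : T.IsRepresentable) (χ : 𝓓(Ω, ℝ)) {f : E → E'} (hf : ContDiff ℝ ∞ f) :
    (T.pushforward Ω' χ hf).mass ≠ ⊤ :=
  ne_top_of_le_ne_top (hT.lintegral_pushforwardDensity_ne_top χ hf)
    (hT.mass_pushforward_le_lintegral χ hf)

end PushforwardMass

section PushforwardMassFD

variable {E E' : Type*} [NormedAddCommGroup E] [NormedSpace ℝ E] [FiniteDimensional ℝ E]
  [MeasurableSpace E] [BorelSpace E] [NormedAddCommGroup E'] [NormedSpace ℝ E']
  [FiniteDimensional ℝ E'] [MeasurableSpace E'] [BorelSpace E']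
  {Ω : Opens E} {Ω' : Opens E'} {m : ℕ}

/-- Push-forwards of representable currents are representable (they even have finite mass).
[cite: Federer1969, 4.1.7] -/
theorem Current.IsRepresentable.pushforward {T : Current Ω m} (hT : T.IsRepresentable)
    (χ : 𝓓(Ω, ℝ)) {f : E → E'} (hf : ContDiff ℝ ∞ f) :
    (T.pushforward Ω' χ hf).IsRepresentable :=
  Current.isRepresentable_of_mass_ne_top _ (hT.mass_pushforward_ne_top χ hf)

/-- **`‖f_# T‖ ≤ f_*(|χ| ‖Df‖ᵐ ‖T‖)` as measures** (Federer 4.1.7: "`‖f_# T‖ ≤ f_#(‖T‖ ⋯)`"): the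
variation measure of the push-forward is dominated by the image of the weighted variation measure.
From the bound on open sets and the outer regularity of the finite image measure.
[cite: Federer1969, 4.1.7] -/
theorem Current.IsRepresentable.variation_pushforward_le_map {T : Current Ω m}
    (hT : T.IsRepresentable) (χ : 𝓓(Ω, ℝ)) {f : E → E'} (hf : ContDiff ℝ ∞ f) :
    (T.pushforward Ω' χ hf).variation ≤
      (T.variation.withDensity (pushforwardDensity χ f m)).map f := by
  set ν : Measure E := T.variation.withDensity (pushforwardDensity χ f m) with hν
  haveI : IsFiniteMeasure ν := ⟨by
    rw [hν, withDensity_apply _ MeasurableSet.univ, Measure.restrict_univ]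
    exact (hT.lintegral_pushforwardDensity_ne_top χ hf).lt_top⟩
  haveI : IsFiniteMeasure (ν.map f) := Measure.isFiniteMeasure_map _ _
  have hfm : Measurable f := hf.continuous.measurable
  refine Measure.le_intro fun B hB _ => ?_
  rw [(T.pushforward Ω' χ hf).variation_eq_iInf_isOpen hB]
  have hbound : ∀ U : Set E', IsOpen U → (T.pushforward Ω' χ hf).variationOn U ≤ (ν.map f) U := by
    intro U hU
    rw [Measure.map_apply hfm hU.measurableSet, hν,
      withDensity_apply _ ((hU.preimage hf.continuous).measurableSet)]
    exact hT.variationOn_pushforward_le χ hf hU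
  calc ⨅ (U : Set E') (_ : IsOpen U) (_ : B ∩ (Ω' : Set E') ⊆ U), (T.pushforward Ω' χ hf).variationOn U
      ≤ ⨅ (U : Set E') (_ : IsOpen U) (_ : B ∩ (Ω' : Set E') ⊆ U), (ν.map f) U :=
        iInf_mono fun U => iInf_mono fun hU => iInf_mono fun _ => hbound U hU
    _ = ⨅ (U : Set E') (_ : B ∩ (Ω' : Set E') ⊆ U) (_ : IsOpen U), (ν.map f) U :=
        iInf_congr fun U => iInf_comm
    _ = (ν.map f) (B ∩ (Ω' : Set E')) := ((B ∩ (Ω' : Set E')).measure_eq_iInf_isOpen _).symm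
    _ ≤ (ν.map f) B := measure_mono inter_subset_left

end PushforwardMassFD

end Literature.Geometry.GeometricMeasureTheory
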